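/-
Copyright (c) 2026 the pub-hodgecm-mathlib formalisation cell (harness21).  Prover seat hodgecm-mathlib-F0P3a-p01 (g36), FLOOR 0, SUPPORTS-ONLY on h413; first hand on the
(L-lev) law producers (tier-0 ED. 5 `stub_law_levLo ∕ stub_law_levHi`, ED. 6 `stub_law_levCleanLo ∕ stub_law_levCleanHi` of `Cruxes/H413/Lines/F0_P3c_DyRamFourFrame.lean`).  2026-09-04.
-/
import Summits.HodgeConjecture.HodgeConjecture.Theorems.F0P3cDyRamKappaCountBoxSum   -- ★ p856906 `sum_box_kappa_eq_typeZero` (the unit identity this Prop truncates and shifts)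
import HarnessLib

/-!
# Crux `H413`, LH4 «(D-RAM) FOUR-FRAME» road, STAGE 1b — DEFS LEAF «(T-box | lev)»: the TWO-TOKEN LABELLED κ-BOX-SUM of the level trunks, as ONE named arithmetic Prop
# `LevLabelledBoxSum ℓ₁ ℓ₂`

Cell `hodgecm-mathlib` (D-0151), crux item H413 = `stmt-HodgeConjecture-24833`, route of record `HCCMUnconditional`.  DEFINITION LEAF (one `def … : Prop` with parameters, no
theorem, no instance, no notation, no `sorry`); lane `--kind definition --supports stmt-HodgeConjecture-24833 --as helper` (count-neutral: it PAYS NO tier-0 row).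
Twin of LH4-p12 (g7)'s ★ p859958 `Literature.Uncategorized.SqLabelledBoxSum` (the square trunk's truncated box-sum), which is the row `(ℓ₁, ℓ₂) = (0, mstarOfRecord d)` of this one.

WHAT IT SAYS (memo `F0/P3a/F0P3a-p01/g36/tbox/TBOX-LEV-SPEC.v1.F0P3ap01g36.md` 7f362386; scripts `levbox.py` ∕ `netcheck.py` there).  Fix the two label tokens of the level trunks
(★ p859562 DEFS №5, ★ p859769 §3, ★ p859848 §3): `D₁ = diag(α−1, β−1, 0)` at level `ℓ₁` and `D₂ = diag((α−1)², (β−1)², 0)` at level `ℓ₂`.  Stratum by stratum over the axis box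
the two-token LABELLED κᵢ-weighted class count of the type-0 vertex lattices is ★ p856906's table with these edits, all decided by the valuation letters of the two tokens
(`v(e₀), v(e₁), v(e₂−e₁), v(e₂−e₀) = m·n₂, m·n₁, m·n₁, m·n₂`, `m = 1, 2`):
* on-branch `T_p(s)`: the apex read `s + ℓ₁ ≤ n_p` replaces `s ≤ n_p`;
* glued `G_p(ρ, s)` TUBE: the extra reads `2ρ + ℓ₁ ≤ n_glue`, `2ρ + s + ℓ₁ ≤ n_apex`, `2ρ + ℓ₂ ≤ 2·n_glue`;
* glued `G_p(ρ, s)` ON THE `D₁`-LOCUS COLUMN (`n_legs = n_glue`, `n_apex = n_glue + s`: the unit's glue FOOT `n_glue < 2ρ` AND the former tubes `n_glue − ℓ₁ < 2ρ ≤ n_glue`): the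
  `D₁`-cut cell `[ℓ₁ + ρ ≤ n_glue ∧ X ≤ n_glue − d + 1 ∧ 2ρ + ℓ₂ ≤ 2·n_glue] · (εG p j · [2d ≤ s + X + 1 (j = p) ∣ 2d ≤ X + 1 (j ≠ p)])ᵢ · q^{2ρ + s∕2 − ⌈X∕2⌉}`, `X = ℓ₁ + 2ρ − n_glue`
  (★ p856906's foot letters with `2ρ − n_glue ↦ ℓ₁ + 2ρ − n_glue`; LH4-p09 (g8)'s on-locus organs ★ `…G1_sep_onLocus_{tube,foot}_of_witness` made numeric by ★ `modelToken_data`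
  + ★ bridge `exists_fixed_v_add_glueUnit_le_iff`, and his two-token heads T2b `…G1_sep_levels_foot ∕ _tube_locusOne`);
* core-hanging `H(ρ)` (equilateral key): the same shift `2ρ − n ↦ ℓ₁ + 2ρ − n` plus `ℓ₁ + ρ ≤ n ∧ 2ρ + ℓ₂ ≤ 2n` (LH4-p09 (g8) T2a `…H_sep_levels_foot`);
* RIGHT-HAND SIDE `SIGN · (q^{k − x} − q^{k − max(x, B + y)})` with `y = 2⌈(ℓ₁ − d%2)∕2⌉`, `x = max(ℓ₁, (⌊(ℓ₂+1)∕2⌋ − ⌊d∕2⌋)⁺ + y∕2)`: the `D₂` level truncates the TOP of the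
  unit's tiling `[k − B, k − 1]`, the `D₁` level truncates the top at `k − ℓ₁` and (every foot-parity step) OPENS TWO LAYERS BELOW the unit's bottom.
Rows of record: lo `(d%2, m*)` ↦ `(x, y) = (csOfRecord, 0)`; hi `(d%2+1, m*)` ↦ `(klOfRecord = cs+1, 2)`; clean-lo `(d%2, mc)` ↦ `(sTOfRecord, 0)`; clean-hi `(d%2+1, mc)` ↦ `(sT+1, 2)`.
HYPOTHESES beyond ★ p856906's: the fence `2d ≤ nᵢ + 1` (LH4-p12 (g7) §1: root guard + ★ trace bound), `ℓ₂ ≤ nᵢ`, `ℓ₁ ≤ 2`, and the corner exclusion `d%2 = 0 → ℓ₁ = 1 → d+1 ≤ ℓ₂`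
(outside it, with `B = 0`, the sum is a type-dependent boundary term; no row of record lives there).
NUMERICAL CERTIFICATE of THIS statement's tables (not a proof): `netcheck.py` — the tables above agree CELL BY CELL with the validated two-token cell model (74 658 empirical
(cell, ℓ₁, ℓ₂, slot) entries at 8 keys, 0 discrepancies) and the identity holds, for d = 2..5, every t ∈ [d−1, d+2], every isoceles key in the fence with Σn ≤ 3·lo+16,
every ℓ₁ ≤ 2, ℓ₂ ≤ min nᵢ (corner excluded), all slots, q ∈ {2, 4}: d = 2: 24 408 ∕ 24 408, d = 3: 30 456 ∕ 30 456, d = 4, 5: `netcheck.d45.out`.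
ED. 2 (append-only): `LevLabelledBoxSumWide` (the fence `ℓ₂ ≤ nᵢ + ℓ₁` the assembler can discharge at every row of record) and `levLabelledBoxSum_of_wide`.
CONSUMERS: its proof `levLabelledBoxSumWide_holds` (next files of this seat) and the (T-asm | lev) assembler (★ p857082 steps (3)–(6) over the per-cell organs) give the four `hTrunk`
binders of ★ p859769 §3 ∕ ★ p859848 §3, hence the four (L-lev) law stubs BY NAME.

HONEST LABEL: a named arithmetic Prop (route-internal bookkeeping identity, NOT a published result — the citations below are context for the letters); count-neutral; tier-0
rows and the ED. 5∕6 stubs stay OPEN; HC_CM is proved only modulo the 7 printed citations (2 remaining named inputs: hLiu418 = `stmt-HodgeConjecture-24832`, h413 =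
`stmt-HodgeConjecture-24833`) until rung 0 closes.

## References
* [Kottwitz1986BaseChangeUnits] R. E. Kottwitz, *Base change for unit elements of Hecke algebras*, Compositio Math. 60 (1986), §1 pp. 240–241 (κ-orbital integrals of units as signed lattice counts).
* [Rogawski1990] J. D. Rogawski, *Automorphic Representations of Unitary Groups in Three Variables*, Ann. of Math. Stud. 123 (1990), §4.9 Prop. 4.9.1 (a) p. 55; §4.10 p. 58.
-/

set_option autoImplicit false

namespace Summit.HodgeConjecture.HodgeConjecture.Cruxes.H413.F0P3cDyRamLevLabelledBoxSumDefs

open Finset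

/-- **`LevLabelledBoxSum ℓ₁ ℓ₂` — THE TWO-TOKEN LABELLED κ-BOX-SUM OF THE LEVEL TRUNKS (brick (T-box | lev), an arithmetic Prop with the two levels as parameters).**
★ p856906 `sum_box_kappa_eq_typeZero`'s statement with: the fence `2d ≤ nᵢ + 1`, `ℓ₂ ≤ nᵢ`, `ℓ₁ ≤ 2`, the corner exclusion; the apex reads `s + ℓ₁ ≤ n_p` on the
on-branch cells; the tube reads `2ρ + ℓ₁ ≤ n_glue ∧ 2ρ + s + ℓ₁ ≤ n_apex ∧ 2ρ + ℓ₂ ≤ 2 n_glue`; the `D₁`-locus column (glue foot and cut tubes) with the shifted letter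
`X = ℓ₁ + 2ρ − n_glue` and the reads `ℓ₁ + ρ ≤ n_glue ∧ 2ρ + ℓ₂ ≤ 2 n_glue`; the hanging `H` likewise; and the right-hand side `SIGN·(q^{k−x} − q^{k−max(x, B+y)})`,
`y = 2·((ℓ₁ + 1 − d%2)∕2)`, `x = max ℓ₁ ((ℓ₂+1)∕2 − d∕2 + (ℓ₁ + 1 − d%2)∕2)` (ℕ arithmetic).  Pure finite-sum bookkeeping over `ℚ` (no lattices). -/
def LevLabelledBoxSum (ℓ₁ ℓ₂ : ℕ) : Prop :=
  ∀ (q : ℕ) {d n₁ n₂ n₃ Bx k : ℕ} (hd : 2 ≤ d)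
    (hiso : (n₁ = n₂ ∧ n₁ ≤ n₃) ∨ (n₁ = n₃ ∧ n₁ ≤ n₂) ∨ (n₂ = n₃ ∧ n₂ ≤ n₁))
    (hfence : 2 * d ≤ n₁ + 1 ∧ 2 * d ≤ n₂ + 1 ∧ 2 * d ≤ n₃ + 1) (hℓ₁ : ℓ₁ ≤ 2) (hℓ₂ : ℓ₂ ≤ n₁ ∧ ℓ₂ ≤ n₂ ∧ ℓ₂ ≤ n₃)
    (hcorner : d % 2 = 0 → ℓ₁ = 1 → d + 1 ≤ ℓ₂)
    (h1 : n₁ % 2 = d % 2) (h2 : n₂ % 2 = d % 2) (h3 : n₃ % 2 = d % 2) (hBx : n₁ + n₂ + n₃ ≤ Bx)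
    (hk : 2 * k + d = n₁ + n₂ + n₃ + 2) (i : Fin 3) (ω εH : ℚ) (εG : Fin 3 → Fin 3 → ℚ)
    (hω0 : i = 0 → n₂ = n₃ → n₂ + 2 * d ≤ n₁ → εG 0 0 = ω) (hω1 : i = 1 → n₁ = n₃ → n₁ + 2 * d ≤ n₂ → εG 1 1 = ω)
    (hω2 : i = 2 → n₁ = n₂ → n₁ + 2 * d ≤ n₃ → εG 2 2 = ω)
    (v : (Fin 3 → ℕ) → ℚ) (hcore : v ![0, 0, 0] = 0)
    (hT1 : ∀ s, 1 ≤ s → v ![0, s, s] = if i = 0 ∧ 2 * d ≤ s ∧ 2 ∣ s ∧ s + ℓ₁ ≤ n₁ then ω * (q : ℚ) ^ (s / 2) else 0)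
    (hT2 : ∀ s, 1 ≤ s → v ![s, 0, s] = if i = 1 ∧ 2 * d ≤ s ∧ 2 ∣ s ∧ s + ℓ₁ ≤ n₂ then ω * (q : ℚ) ^ (s / 2) else 0)
    (hT3 : ∀ s, 1 ≤ s → v ![s, s, 0] = if i = 2 ∧ 2 * d ≤ s ∧ 2 ∣ s ∧ s + ℓ₁ ≤ n₃ then ω * (q : ℚ) ^ (s / 2) else 0)
    (hG1 : ∀ ρ s, 1 ≤ ρ → 1 ≤ s → v ![2 * ρ, 2 * ρ + s, 2 * ρ + s] =
      (if 2 ∣ s ∧ 2 * ρ ≤ min n₂ n₃ ∧ 2 * ρ + s ≤ n₁ ∧ 2 * ρ + ℓ₁ ≤ n₂ ∧ 2 * ρ + s + ℓ₁ ≤ n₁ ∧ 2 * ρ + ℓ₂ ≤ 2 * n₂ then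
          (![ω * (q : ℚ) ^ (2 * ρ + s / 2 - 1) * ((if 2 * d ≤ s then (q : ℚ) - 1 else 0) - (if s + 2 = 2 * d then 1 else 0)), 0, 0] : Fin 3 → ℚ) i
        else 0) +
      (if 2 ∣ s ∧ n₂ = n₃ ∧ n₁ = n₂ + s ∧ n₂ < 2 * ρ + ℓ₁ ∧ ℓ₁ + ρ ≤ n₂ ∧ ℓ₁ + 2 * ρ - n₂ ≤ n₂ - d + 1 ∧ 2 * ρ + ℓ₂ ≤ 2 * n₂ then
          (![if 2 * d ≤ s + (ℓ₁ + 2 * ρ - n₂ + 1) then εG 0 0 else 0,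
             if 2 * d ≤ ℓ₁ + 2 * ρ - n₂ + 1 then εG 0 1 else 0,
             if 2 * d ≤ ℓ₁ + 2 * ρ - n₂ + 1 then εG 0 2 else 0] : Fin 3 → ℚ) i * (q : ℚ) ^ (2 * ρ + s / 2 - (ℓ₁ + 2 * ρ - n₂ + 1) / 2)
        else 0))
    (hG2 : ∀ ρ s, 1 ≤ ρ → 1 ≤ s → v ![2 * ρ + s, 2 * ρ, 2 * ρ + s] =
      (if 2 ∣ s ∧ 2 * ρ ≤ min n₁ n₃ ∧ 2 * ρ + s ≤ n₂ ∧ 2 * ρ + ℓ₁ ≤ n₁ ∧ 2 * ρ + s + ℓ₁ ≤ n₂ ∧ 2 * ρ + ℓ₂ ≤ 2 * n₁ then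
          (![0, ω * (q : ℚ) ^ (2 * ρ + s / 2 - 1) * ((if 2 * d ≤ s then (q : ℚ) - 1 else 0) - (if s + 2 = 2 * d then 1 else 0)), 0] : Fin 3 → ℚ) i
        else 0) +
      (if 2 ∣ s ∧ n₁ = n₃ ∧ n₂ = n₁ + s ∧ n₁ < 2 * ρ + ℓ₁ ∧ ℓ₁ + ρ ≤ n₁ ∧ ℓ₁ + 2 * ρ - n₁ ≤ n₁ - d + 1 ∧ 2 * ρ + ℓ₂ ≤ 2 * n₁ then
          (![if 2 * d ≤ ℓ₁ + 2 * ρ - n₁ + 1 then εG 1 0 else 0,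
             if 2 * d ≤ s + (ℓ₁ + 2 * ρ - n₁ + 1) then εG 1 1 else 0,
             if 2 * d ≤ ℓ₁ + 2 * ρ - n₁ + 1 then εG 1 2 else 0] : Fin 3 → ℚ) i * (q : ℚ) ^ (2 * ρ + s / 2 - (ℓ₁ + 2 * ρ - n₁ + 1) / 2)
        else 0))
    (hG3 : ∀ ρ s, 1 ≤ ρ → 1 ≤ s → v ![2 * ρ + s, 2 * ρ + s, 2 * ρ] =
      (if 2 ∣ s ∧ 2 * ρ ≤ min n₁ n₂ ∧ 2 * ρ + s ≤ n₃ ∧ 2 * ρ + ℓ₁ ≤ n₂ ∧ 2 * ρ + s + ℓ₁ ≤ n₃ ∧ 2 * ρ + ℓ₂ ≤ 2 * n₂ then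
          (![0, 0, ω * (q : ℚ) ^ (2 * ρ + s / 2 - 1) * ((if 2 * d ≤ s then (q : ℚ) - 1 else 0) - (if s + 2 = 2 * d then 1 else 0))] : Fin 3 → ℚ) i
        else 0) +
      (if 2 ∣ s ∧ n₁ = n₂ ∧ n₃ = n₁ + s ∧ n₁ < 2 * ρ + ℓ₁ ∧ ℓ₁ + ρ ≤ n₁ ∧ ℓ₁ + 2 * ρ - n₁ ≤ n₁ - d + 1 ∧ 2 * ρ + ℓ₂ ≤ 2 * n₁ then
          (![if 2 * d ≤ ℓ₁ + 2 * ρ - n₁ + 1 then εG 2 0 else 0,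
             if 2 * d ≤ ℓ₁ + 2 * ρ - n₁ + 1 then εG 2 1 else 0,
             if 2 * d ≤ s + (ℓ₁ + 2 * ρ - n₁ + 1) then εG 2 2 else 0] : Fin 3 → ℚ) i * (q : ℚ) ^ (2 * ρ + s / 2 - (ℓ₁ + 2 * ρ - n₁ + 1) / 2)
        else 0))
    (hH : ∀ ρ, 1 ≤ ρ → v ![2 * ρ, 2 * ρ, 2 * ρ] =
      if n₁ = n₂ ∧ n₂ = n₃ ∧ n₁ < 2 * ρ + ℓ₁ ∧ ℓ₁ + 2 * ρ - n₁ ≤ n₁ - d + 1 ∧ d ≤ (ℓ₁ + 2 * ρ - n₁ + 1) / 2 ∧ ℓ₁ + ρ ≤ n₁ ∧ 2 * ρ + ℓ₂ ≤ 2 * n₁ then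
        εH * (q : ℚ) ^ (2 * ρ - (ℓ₁ + 2 * ρ - n₁ + 1) / 2) else 0)
    (hzero : ∀ a : Fin 3 → ℕ, ¬ ((a = ![0, 0, 0]) ∨
      (∃ s, 2 ∣ s ∧ 2 ≤ s ∧ (a = ![0, s, s] ∨ a = ![s, 0, s] ∨ a = ![s, s, 0])) ∨
      (∃ ρ s, 1 ≤ ρ ∧ 2 ∣ s ∧ 2 ≤ s ∧ (a = ![2 * ρ, 2 * ρ + s, 2 * ρ + s] ∨ a = ![2 * ρ + s, 2 * ρ, 2 * ρ + s] ∨ a = ![2 * ρ + s, 2 * ρ + s, 2 * ρ])) ∨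
      (∃ ρ, 1 ≤ ρ ∧ a = ![2 * ρ, 2 * ρ, 2 * ρ])) → v a = 0),
    ((q : ℚ) - 1) * ∑ a : Fin 3 → Fin (Bx + 1), v (fun j => (a j : ℕ)) =
      (if n₁ = n₂ ∧ n₂ = n₃ then εH else if n₂ = n₃ then εG 0 i else if n₁ = n₃ then εG 1 i else εG 2 i) *
        ((q : ℚ) ^ (k - max ℓ₁ ((ℓ₂ + 1) / 2 - d / 2 + (ℓ₁ + 1 - d % 2) / 2)) -
          (q : ℚ) ^ (k - max (max ℓ₁ ((ℓ₂ + 1) / 2 - d / 2 + (ℓ₁ + 1 - d % 2) / 2))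
            ((((![n₁, n₂, n₃] : Fin 3 → ℕ) i + 2 * (d % 2) + 2 - 3 * d) / 2) + 2 * ((ℓ₁ + 1 - d % 2) / 2))))

/-- **`LevLabelledBoxSumWide ℓ₁ ℓ₂` — THE SAME IDENTITY ON THE WIDE FENCE `ℓ₂ ≤ nᵢ + ℓ₁`** (the form the (T-asm | lev) assembler consumes: at ODD `d` the lo∕hi rows have
`ℓ₂ = mstarOfRecord d = 2d` while the honest fence allows `nᵢ = 2d − 1`, and there `ℓ₂ ≤ nᵢ + ℓ₁` holds with `ℓ₁ ∈ {1, 2}`; certified cell-by-cell on `ℓ₂ ∈ {min nᵢ + 1, min nᵢ + 2}`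
by `netcheck_boundary2.py`: d = 2..5, every ℓ₁ ≤ 2 with `ℓ₂ ≤ min nᵢ + ℓ₁`, 0 cellbad ∕ 0 sumbad; beyond `nᵢ + ℓ₁` the on-branch top cell `s = n_p` dies under `D₂` and the tables change).
★ p856906 `sum_box_kappa_eq_typeZero`'s statement with: the fence `2d ≤ nᵢ + 1`, `ℓ₂ ≤ nᵢ`, `ℓ₁ ≤ 2`, the corner exclusion; the apex reads `s + ℓ₁ ≤ n_p` on the
on-branch cells; the tube reads `2ρ + ℓ₁ ≤ n_glue ∧ 2ρ + s + ℓ₁ ≤ n_apex ∧ 2ρ + ℓ₂ ≤ 2 n_glue`; the `D₁`-locus column (glue foot and cut tubes) with the shifted letter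
`X = ℓ₁ + 2ρ − n_glue` and the reads `ℓ₁ + ρ ≤ n_glue ∧ 2ρ + ℓ₂ ≤ 2 n_glue`; the hanging `H` likewise; and the right-hand side `SIGN·(q^{k−x} − q^{k−max(x, B+y)})`,
`y = 2·((ℓ₁ + 1 − d%2)∕2)`, `x = max ℓ₁ ((ℓ₂+1)∕2 − d∕2 + (ℓ₁ + 1 − d%2)∕2)` (ℕ arithmetic).  Pure finite-sum bookkeeping over `ℚ` (no lattices). -/
def LevLabelledBoxSumWide (ℓ₁ ℓ₂ : ℕ) : Prop :=
  ∀ (q : ℕ) {d n₁ n₂ n₃ Bx k : ℕ} (hd : 2 ≤ d)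
    (hiso : (n₁ = n₂ ∧ n₁ ≤ n₃) ∨ (n₁ = n₃ ∧ n₁ ≤ n₂) ∨ (n₂ = n₃ ∧ n₂ ≤ n₁))
    (hfence : 2 * d ≤ n₁ + 1 ∧ 2 * d ≤ n₂ + 1 ∧ 2 * d ≤ n₃ + 1) (hℓ₁ : ℓ₁ ≤ 2) (hℓ₂ : ℓ₂ ≤ n₁ + ℓ₁ ∧ ℓ₂ ≤ n₂ + ℓ₁ ∧ ℓ₂ ≤ n₃ + ℓ₁)
    (hcorner : d % 2 = 0 → ℓ₁ = 1 → d + 1 ≤ ℓ₂)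
    (h1 : n₁ % 2 = d % 2) (h2 : n₂ % 2 = d % 2) (h3 : n₃ % 2 = d % 2) (hBx : n₁ + n₂ + n₃ ≤ Bx)
    (hk : 2 * k + d = n₁ + n₂ + n₃ + 2) (i : Fin 3) (ω εH : ℚ) (εG : Fin 3 → Fin 3 → ℚ)
    (hω0 : i = 0 → n₂ = n₃ → n₂ + 2 * d ≤ n₁ → εG 0 0 = ω) (hω1 : i = 1 → n₁ = n₃ → n₁ + 2 * d ≤ n₂ → εG 1 1 = ω)
    (hω2 : i = 2 → n₁ = n₂ → n₁ + 2 * d ≤ n₃ → εG 2 2 = ω)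
    (v : (Fin 3 → ℕ) → ℚ) (hcore : v ![0, 0, 0] = 0)
    (hT1 : ∀ s, 1 ≤ s → v ![0, s, s] = if i = 0 ∧ 2 * d ≤ s ∧ 2 ∣ s ∧ s + ℓ₁ ≤ n₁ then ω * (q : ℚ) ^ (s / 2) else 0)
    (hT2 : ∀ s, 1 ≤ s → v ![s, 0, s] = if i = 1 ∧ 2 * d ≤ s ∧ 2 ∣ s ∧ s + ℓ₁ ≤ n₂ then ω * (q : ℚ) ^ (s / 2) else 0)
    (hT3 : ∀ s, 1 ≤ s → v ![s, s, 0] = if i = 2 ∧ 2 * d ≤ s ∧ 2 ∣ s ∧ s + ℓ₁ ≤ n₃ then ω * (q : ℚ) ^ (s / 2) else 0)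
    (hG1 : ∀ ρ s, 1 ≤ ρ → 1 ≤ s → v ![2 * ρ, 2 * ρ + s, 2 * ρ + s] =
      (if 2 ∣ s ∧ 2 * ρ ≤ min n₂ n₃ ∧ 2 * ρ + s ≤ n₁ ∧ 2 * ρ + ℓ₁ ≤ n₂ ∧ 2 * ρ + s + ℓ₁ ≤ n₁ ∧ 2 * ρ + ℓ₂ ≤ 2 * n₂ then
          (![ω * (q : ℚ) ^ (2 * ρ + s / 2 - 1) * ((if 2 * d ≤ s then (q : ℚ) - 1 else 0) - (if s + 2 = 2 * d then 1 else 0)), 0, 0] : Fin 3 → ℚ) i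
        else 0) +
      (if 2 ∣ s ∧ n₂ = n₃ ∧ n₁ = n₂ + s ∧ n₂ < 2 * ρ + ℓ₁ ∧ ℓ₁ + ρ ≤ n₂ ∧ ℓ₁ + 2 * ρ - n₂ ≤ n₂ - d + 1 ∧ 2 * ρ + ℓ₂ ≤ 2 * n₂ then
          (![if 2 * d ≤ s + (ℓ₁ + 2 * ρ - n₂ + 1) then εG 0 0 else 0,
             if 2 * d ≤ ℓ₁ + 2 * ρ - n₂ + 1 then εG 0 1 else 0,
             if 2 * d ≤ ℓ₁ + 2 * ρ - n₂ + 1 then εG 0 2 else 0] : Fin 3 → ℚ) i * (q : ℚ) ^ (2 * ρ + s / 2 - (ℓ₁ + 2 * ρ - n₂ + 1) / 2)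
        else 0))
    (hG2 : ∀ ρ s, 1 ≤ ρ → 1 ≤ s → v ![2 * ρ + s, 2 * ρ, 2 * ρ + s] =
      (if 2 ∣ s ∧ 2 * ρ ≤ min n₁ n₃ ∧ 2 * ρ + s ≤ n₂ ∧ 2 * ρ + ℓ₁ ≤ n₁ ∧ 2 * ρ + s + ℓ₁ ≤ n₂ ∧ 2 * ρ + ℓ₂ ≤ 2 * n₁ then
          (![0, ω * (q : ℚ) ^ (2 * ρ + s / 2 - 1) * ((if 2 * d ≤ s then (q : ℚ) - 1 else 0) - (if s + 2 = 2 * d then 1 else 0)), 0] : Fin 3 → ℚ) i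
        else 0) +
      (if 2 ∣ s ∧ n₁ = n₃ ∧ n₂ = n₁ + s ∧ n₁ < 2 * ρ + ℓ₁ ∧ ℓ₁ + ρ ≤ n₁ ∧ ℓ₁ + 2 * ρ - n₁ ≤ n₁ - d + 1 ∧ 2 * ρ + ℓ₂ ≤ 2 * n₁ then
          (![if 2 * d ≤ ℓ₁ + 2 * ρ - n₁ + 1 then εG 1 0 else 0,
             if 2 * d ≤ s + (ℓ₁ + 2 * ρ - n₁ + 1) then εG 1 1 else 0,
             if 2 * d ≤ ℓ₁ + 2 * ρ - n₁ + 1 then εG 1 2 else 0] : Fin 3 → ℚ) i * (q : ℚ) ^ (2 * ρ + s / 2 - (ℓ₁ + 2 * ρ - n₁ + 1) / 2)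
        else 0))
    (hG3 : ∀ ρ s, 1 ≤ ρ → 1 ≤ s → v ![2 * ρ + s, 2 * ρ + s, 2 * ρ] =
      (if 2 ∣ s ∧ 2 * ρ ≤ min n₁ n₂ ∧ 2 * ρ + s ≤ n₃ ∧ 2 * ρ + ℓ₁ ≤ n₂ ∧ 2 * ρ + s + ℓ₁ ≤ n₃ ∧ 2 * ρ + ℓ₂ ≤ 2 * n₂ then
          (![0, 0, ω * (q : ℚ) ^ (2 * ρ + s / 2 - 1) * ((if 2 * d ≤ s then (q : ℚ) - 1 else 0) - (if s + 2 = 2 * d then 1 else 0))] : Fin 3 → ℚ) i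
        else 0) +
      (if 2 ∣ s ∧ n₁ = n₂ ∧ n₃ = n₁ + s ∧ n₁ < 2 * ρ + ℓ₁ ∧ ℓ₁ + ρ ≤ n₁ ∧ ℓ₁ + 2 * ρ - n₁ ≤ n₁ - d + 1 ∧ 2 * ρ + ℓ₂ ≤ 2 * n₁ then
          (![if 2 * d ≤ ℓ₁ + 2 * ρ - n₁ + 1 then εG 2 0 else 0,
             if 2 * d ≤ ℓ₁ + 2 * ρ - n₁ + 1 then εG 2 1 else 0,
             if 2 * d ≤ s + (ℓ₁ + 2 * ρ - n₁ + 1) then εG 2 2 else 0] : Fin 3 → ℚ) i * (q : ℚ) ^ (2 * ρ + s / 2 - (ℓ₁ + 2 * ρ - n₁ + 1) / 2)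
        else 0))
    (hH : ∀ ρ, 1 ≤ ρ → v ![2 * ρ, 2 * ρ, 2 * ρ] =
      if n₁ = n₂ ∧ n₂ = n₃ ∧ n₁ < 2 * ρ + ℓ₁ ∧ ℓ₁ + 2 * ρ - n₁ ≤ n₁ - d + 1 ∧ d ≤ (ℓ₁ + 2 * ρ - n₁ + 1) / 2 ∧ ℓ₁ + ρ ≤ n₁ ∧ 2 * ρ + ℓ₂ ≤ 2 * n₁ then
        εH * (q : ℚ) ^ (2 * ρ - (ℓ₁ + 2 * ρ - n₁ + 1) / 2) else 0)
    (hzero : ∀ a : Fin 3 → ℕ, ¬ ((a = ![0, 0, 0]) ∨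
      (∃ s, 2 ∣ s ∧ 2 ≤ s ∧ (a = ![0, s, s] ∨ a = ![s, 0, s] ∨ a = ![s, s, 0])) ∨
      (∃ ρ s, 1 ≤ ρ ∧ 2 ∣ s ∧ 2 ≤ s ∧ (a = ![2 * ρ, 2 * ρ + s, 2 * ρ + s] ∨ a = ![2 * ρ + s, 2 * ρ, 2 * ρ + s] ∨ a = ![2 * ρ + s, 2 * ρ + s, 2 * ρ])) ∨
      (∃ ρ, 1 ≤ ρ ∧ a = ![2 * ρ, 2 * ρ, 2 * ρ])) → v a = 0),
    ((q : ℚ) - 1) * ∑ a : Fin 3 → Fin (Bx + 1), v (fun j => (a j : ℕ)) =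
      (if n₁ = n₂ ∧ n₂ = n₃ then εH else if n₂ = n₃ then εG 0 i else if n₁ = n₃ then εG 1 i else εG 2 i) *
        ((q : ℚ) ^ (k - max ℓ₁ ((ℓ₂ + 1) / 2 - d / 2 + (ℓ₁ + 1 - d % 2) / 2)) -
          (q : ℚ) ^ (k - max (max ℓ₁ ((ℓ₂ + 1) / 2 - d / 2 + (ℓ₁ + 1 - d % 2) / 2))
            ((((![n₁, n₂, n₃] : Fin 3 → ℕ) i + 2 * (d % 2) + 2 - 3 * d) / 2) + 2 * ((ℓ₁ + 1 - d % 2) / 2))))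

/-- The wide-fence Prop implies the interior one (`ℓ₂ ≤ nᵢ ⇒ ℓ₂ ≤ nᵢ + ℓ₁`); the proof of record targets `LevLabelledBoxSumWide`. -/
theorem levLabelledBoxSum_of_wide (ℓ₁ ℓ₂ : ℕ) (h : LevLabelledBoxSumWide ℓ₁ ℓ₂) : LevLabelledBoxSum ℓ₁ ℓ₂ := by
  intro q d n₁ n₂ n₃ Bx k hd hiso hfence hℓ₁ hℓ₂ hcorner h1 h2 h3 hBx hk i ω εH εG hω0 hω1 hω2 v hcore hT1 hT2 hT3 hG1 hG2 hG3 hH hzero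
  exact h q hd hiso hfence hℓ₁ ⟨by omega, by omega, by omega⟩ hcorner h1 h2 h3 hBx hk i ω εH εG hω0 hω1 hω2 v hcore hT1 hT2 hT3 hG1 hG2
    hG3 hH hzero

end Summit.HodgeConjecture.HodgeConjecture.Cruxes.H413.F0P3cDyRamLevLabelledBoxSumDefs
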